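import Summits.QuantumFields.YangMills.Theorems.BalabanUVNodesN16AtKeyedHome
import Summits.QuantumFields.YangMills.Theorems.BalabanUVNodesRateCarriersOfRecord12
import HarnessLib

/-!
# Route «BalabanUVNodes», cluster K4 «SpineRates» — node N16 = NE3 AT THE STAGE-12 RATE-RECORD HOME `RRec₁₂ 𝔯` BY NAME: the two 3-line certificates
# `admits_rRec₁₂` ∕ `attains_rRec₁₂` over the stage-generic module `BalabanUVNodesN16AtKeyedHome`, whence the knit `S_N16 (RRec₁₂ 𝔯)` from `InEndRegime` ∧
# `PrintSlot` at the reading's NE3 bundles, its θ-form, N21's face and the junk tests — the Stage-12 re-key of this seat's file 4 (`…N16AtRRec11`, located-vacuous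
# at Stage 11 per node00-def-T LOCATED-2) with the one signature change: the reading is taken at `(h.params, h.provisos)`

Cell `pub-ymgap`, seat `pub-ymgap-dag-n16-e` (R134 acceleration seat (a), strategy s2 = BY-NAME KNIT at the record; HUMAN RULING D-0062; chair R424 venue),
generation 2, file 6 (THEOREMS ONLY, 0 `def`, 0 `sorry`).  `bears_on: R4∕N16 · K3 SpineGivenEndpointR11 (→ its Stage-12 successor)`.  Filed `--supports
stmt-QuantumFields-19676`.  Imports this seat's file 5 `BalabanUVNodesN16AtKeyedHome` (p462618: `s_N16_of_admits_inEndRegime_printSlot`, `s_N16_of_admits_forall_params`,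
`covRoot_of_attains`, `s_N16_of_admits_flat`, `not_s_N16_of_pins_negLip`; through it files 1–4 and layer B at ₁₁) and dag-n22-e g2's LAYER B AT STAGE 12
`BalabanUVNodesRateCarriersOfRecord12` (`RateReading₁₂` — `lit F θ hP g₀ os`, `ne1 F θ hP g₀ os` —, `rateCarriersOfRecord₁₂ 𝔯 F θ hP g₀ os k`,
`RRec₁₂ 𝔯 := fun F D g₀ os R => ∃ (h : Node00.IsDatumOfRecord₁₂C F N D) (k : ℕ), R = rateCarriersOfRecord₁₂ 𝔯 F h.params h.provisos g₀ os k`, over node00-def-RR-2 g2's key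
`Node00/Record12DatumKey.lean`: `IsDatumOfRecord₁₂C F N D`, `.params`, `.provisos`, `.admissible`).  Restates nothing; cites by name.

CONTENT.
§1 THE STAGE-12 INSTANCE CERTIFICATES — `admits_rRec₁₂` (every bundle `RRec₁₂ 𝔯` pins at `(F, D, g₀, os)` has NE3 component `ne3OfRecord₁₁ F ((𝔯.lit F h.params h.provisos
   g₀ os).ne3 k)` for some key proof `h : IsDatumOfRecord₁₂C F N D` and run length `k`) and `attains_rRec₁₂` (conversely, witness `rateCarriersOfRecord₁₂ 𝔯 F h.params
   h.provisos g₀ os k` — layer B's `rRec₁₂_self`).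
§2 THE KNIT AT THE STAGE-12 HOME — **`s_N16_rRec₁₂_of_inEndRegime_printSlot`**: `S_N16 (RRec₁₂ 𝔯)` from the proviso `InEndRegime` and the print-form slot `PrintSlot` at
   every bundle of the reading (file 5's knit at the certificate); **`s_N16_rRec₁₂_of_forall_admissible`**: the θ-SUFFICIENT form — proviso + slot at the reading for EVERY
   `θ : Stage12Params F N` with provisos `hP : θ.Provisos₁₂ F N` and `θ.Admissible F N`, along every `(g₀, os, k)` (file 5's `s_N16_of_admits_forall_params` with the
   parameter type «Stage-12 tuples with provisos» and the good set «admissible»; no canonical parameter in sight); `s_N16_rRec₁₂_of_canonical_printSlot`: a reading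
   pinned AT THE CANONICAL LETTERS (file 5 v1.1 §6) owes `PrintSlot` only.
§3 N21's FACE AT THE STAGE-12 HOME — `covRoot_rRec₁₂` (under `S_N16 (RRec₁₂ 𝔯)`, the covariant root at every key, `(g₀, os)` and run length; what dag-n21-d's
   Stage-12 module reads as `hcov`).
§4 THE JUNK TESTS AT THE STAGE-12 HOME [decided toys] — `s_N16_rRec₁₂_of_flatReading` (a reading with flat NE3 data closes the stub with no content),
   `not_s_N16_rRec₁₂_of_negLipReading` (a reading with a `Λ₁ = −1` flat object at the canonical parameter of SOME Stage-12 datum of record refutes it),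
   `exists_reading₁₂_ne3_const` (constant readings exist at any prescribed NE3 objects), hence `exists_reading_s_N16_rRec₁₂` (SOME reading closes the stub outright) and
   `exists_reading_not_s_N16_rRec₁₂` (given `∃ F D, IsDatumOfRecord₁₂C F N D` — the datum shadow of K0′ `Record12Inhabited` at rank `N`, OPEN — SOME reading refutes it):
   `S_N16 (RRec₁₂ 𝔯)` carries content exactly through the PIN of `𝔯.lit · ne3` (letters inside `InEndRegime`; `dom` = the data the two-run consumers compare).

HONEST FRAMING.  Kernel bookkeeping by name; no estimate; the proviso and the slot (`PrintSlot` = N05's [Balaban1985RegularSpaces] Theorem 4 in the all-torus geometry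
at the record's pairs + N07's [Balaban1985Variational] Thm 1 (8)+(10) `LeafH3sup`) are HYPOTHESES, proved nowhere in the tree; the reading `𝔯` is UNPINNED (LOCATED,
this seat g0∕g2: N16's `sfClass`∕`IsMinimiser` world averages with [Balaban1985Averaging] (42) `B7Prop2Explicit.avgIter`, the record with [Balaban1987RG1] (0.4)
`BlockAveraging.blockAvg expMeanLogSU` — the pin is a transfer, not a dictionary); no inhabitant of `IsDatumOfRecord₁₂C` is claimed (K0′ OPEN); `S_N16 (RRec₁₂ 𝔯)` is NOT
proved for any reading of record; **N16 ∕ NE3 is NOT discharged**; count-neutral; one finite four-torus at fixed ε — NOT ℝ⁴, NOT infinite volume, NOT OS, NOT a mass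
gap, NOT Clay.
-/

set_option autoImplicit false

open scoped BigOperators Matrix Matrix.Norms.L2Operator
open NormedSpace

namespace Summit.QuantumFields.YangMills.BalabanUVNodes.N16AtRRec12

open Literature.MathematicalPhysics.QuantumFieldTheory.Balaban1983to89
open Literature.MathematicalPhysics.QuantumFieldTheory.Balaban1983to89.T4Continuum (T4Family ULoop FiniteEpsData)
open B7Prop1Explicit B7Prop2Explicit
open T4AveragingDeficitWallBoundary (IsPeriodicCfg)
open Node00 (IsDatumOfRecord₁₂C Stage12Params NE3Objects₁₁ RateObjects₁₁ ne3LOfRecord₁₁ nonempty_rateObjects₁₁)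
open Summit.QuantumFields.BalabanUV.T4Continuum
open MinimalActionRate (sfClass)
open MinimalActionRefine (gradConst)
open MinimalActionWitness (flatCfg)
open NE3EnergyShapes (IsUnitarySite)
open NE3EnergyWeightedCovShape (NE3EnergyRateWCov)
open NE1p.DressedRoot (growingTower)
open YMDAG.UVSplit (Datum NE3Carriers RateCarriers RateRecordPred N16At S_N16 ne3OfRecord₁₁ RateReading₁₂ rateCarriersOfRecord₁₂ RRec₁₂ rRec₁₂_self)
open Summit.QuantumFields.YangMills.BalabanUVNodes.N16Regime (PrintSlot InEndRegime radiusOfRecord constOfRecord)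
open Summit.QuantumFields.YangMills.BalabanUVNodes.N16AtKeyedHome (s_N16_of_admits_inEndRegime_printSlot s_N16_of_admits_forall_params covRoot_of_attains
  s_N16_of_admits_flat not_s_N16_of_pins_negLip s_N16_of_admits_canonical_printSlot)

noncomputable section

variable {N : ℕ} [NeZero N]

/-! ## §1 The Stage-12 instance certificates -/

/-- **`RRec₁₂ 𝔯` ADMITS only the literals of its reading** (`key := IsDatumOfRecord₁₂C`, `ne3At h g₀ os k := (𝔯.lit F h.params h.provisos g₀ os).ne3 k`; `rfl` on the
bundle's third component). [folklore] -/
theorem admits_rRec₁₂ (𝔯 : RateReading₁₂ N) (F : T4Family) (D : Datum F N) (g₀ : ℕ → ℝ) (os : List (ULoop F)) (R : RateCarriers N)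
    (hR : RRec₁₂ 𝔯 F D g₀ os R) :
    ∃ (h : IsDatumOfRecord₁₂C F N D) (k : ℕ), R.ne3 = ne3OfRecord₁₁ F ((𝔯.lit F h.params h.provisos g₀ os).ne3 k) := by
  obtain ⟨h, k, rfl⟩ := hR
  exact ⟨h, k, rfl⟩

/-- **`RRec₁₂ 𝔯` ATTAINS every literal of its reading** (witness: the run-length-`k` bundle at the canonical parameter with its provisos, layer B's `rRec₁₂_self`).
[folklore] -/
theorem attains_rRec₁₂ (𝔯 : RateReading₁₂ N) (F : T4Family) (D : Datum F N) (h : IsDatumOfRecord₁₂C F N D) (g₀ : ℕ → ℝ) (os : List (ULoop F)) (k : ℕ) :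
    ∃ R : RateCarriers N, RRec₁₂ 𝔯 F D g₀ os R ∧ R.ne3 = ne3OfRecord₁₁ F ((𝔯.lit F h.params h.provisos g₀ os).ne3 k) :=
  ⟨rateCarriersOfRecord₁₂ 𝔯 F h.params h.provisos g₀ os k, rRec₁₂_self 𝔯 h g₀ os k, rfl⟩

/-! ## §2 The knit at the Stage-12 home and its θ-form -/

/-- **THE KNIT AT THE STAGE-12 HOME OF RECORD — `S_N16 (RRec₁₂ 𝔯)` FROM THE PROVISO AND THE SLOT AT EVERY BUNDLE OF THE READING**: if at every Stage-12 datum of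
record (key `hD`, canonical parameter `hD.params` with provisos `hD.provisos`), every `(g₀, os)` and every run length `k` the NE3 bundle
`ne3OfRecord₁₁ F ((𝔯.lit F hD.params hD.provisos g₀ os).ne3 k)` satisfies `InEndRegime` (the pin's display) and carries `PrintSlot` (the pin's content: N05's Theorem 4
at the bundle's pairs + N07's `LeafH3sup`), then `S_N16 (RRec₁₂ 𝔯)` — file 5's stage-generic knit at the certificate `admits_rRec₁₂`.  Neither hypothesis is asserted
here. [folklore] -/
theorem s_N16_rRec₁₂_of_inEndRegime_printSlot (𝔯 : RateReading₁₂ N)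
    (h : ∀ (F : T4Family) (D : Datum F N) (hD : IsDatumOfRecord₁₂C F N D) (g₀ : ℕ → ℝ) (os : List (ULoop F)) (k : ℕ),
      InEndRegime (ne3OfRecord₁₁ F ((𝔯.lit F hD.params hD.provisos g₀ os).ne3 k)) ∧
        PrintSlot (ne3OfRecord₁₁ F ((𝔯.lit F hD.params hD.provisos g₀ os).ne3 k))) :
    S_N16 (RRec₁₂ 𝔯) :=
  s_N16_of_admits_inEndRegime_printSlot (key := fun F D => IsDatumOfRecord₁₂C F N D)
    (fun hD g₀ os k => (𝔯.lit _ hD.params hD.provisos g₀ os).ne3 k) (RRec₁₂ 𝔯) (admits_rRec₁₂ 𝔯) h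

/-- **THE θ-SUFFICIENT FORM OF THE KNIT AT STAGE 12** — what a prover of the pin discharges, with no canonical parameter in sight: the proviso and the slot at the
reading's NE3 bundles for EVERY `θ : Stage12Params F N` with provisos `hP : θ.Provisos₁₂ F N` and `θ.Admissible F N`, along every `(g₀, os, k)` (file 5's
`s_N16_of_admits_forall_params` with the parameter type «Stage-12 tuples with provisos», `par hD := ⟨hD.params, hD.provisos⟩`, good set «admissible» — RR-2's
`IsDatumOfRecord₁₂C.admissible`). [folklore] -/
theorem s_N16_rRec₁₂_of_forall_admissible (𝔯 : RateReading₁₂ N)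
    (h : ∀ (F : T4Family) (θ : Stage12Params F N) (hP : θ.Provisos₁₂ F N), θ.Admissible F N → ∀ (g₀ : ℕ → ℝ) (os : List (ULoop F)) (k : ℕ),
      InEndRegime (ne3OfRecord₁₁ F ((𝔯.lit F θ hP g₀ os).ne3 k)) ∧ PrintSlot (ne3OfRecord₁₁ F ((𝔯.lit F θ hP g₀ os).ne3 k))) :
    S_N16 (RRec₁₂ 𝔯) :=
  s_N16_of_admits_forall_params (key := fun F D => IsDatumOfRecord₁₂C F N D)
    (fun hD g₀ os k => (𝔯.lit _ hD.params hD.provisos g₀ os).ne3 k) (RRec₁₂ 𝔯)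
    (Θ := fun F => {θ : Stage12Params F N // θ.Provisos₁₂ F N}) (fun F θ g₀ os k => (𝔯.lit F θ.1 θ.2 g₀ os).ne3 k)
    (fun F θ => θ.1.Admissible F N) (fun hD => ⟨hD.params, hD.provisos⟩) (fun _ _ hD => hD.admissible) (fun _ _ _ _ _ _ => rfl)
    (admits_rRec₁₂ 𝔯) fun F θ hA g₀ os k => h F θ.1 θ.2 hA g₀ os k

/-- **A STAGE-12 READING PINNED AT THE CANONICAL LETTERS OWES `PrintSlot` ONLY**: if every NE3 object of the reading (all families, Stage-12 tuples with provisos,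
`(g₀, os)`, run lengths) carries THE END's thresholds themselves as letters — `⟨Nper, r, r∕2, g, Cof, r, Λ₂', dom⟩`, `r = radiusOfRecord N F.L Nper`,
`Cof = constOfRecord N F.L Nper g`, for SOME `Nper ≥ 1`, `g > 0`, `Λ₂'`, `dom` — then `PrintSlot` at every key bundle ALONE gives `S_N16 (RRec₁₂ 𝔯)` (file 5 v1.1's
`s_N16_of_admits_canonical_printSlot` at the certificate; the proviso is discharged by `inEndRegime_ne3OfRecord₁₁_canonical`). [folklore] -/
theorem s_N16_rRec₁₂_of_canonical_printSlot (𝔯 : RateReading₁₂ N)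
    (hcanon : ∀ (F : T4Family) (θ : Stage12Params F N) (hP : θ.Provisos₁₂ F N) (g₀ : ℕ → ℝ) (os : List (ULoop F)) (k : ℕ),
      ∃ (Nper : ℕ) (g Λ₂' : ℝ) (dom : Set (Site 4 → Fin 4 → (Matrix (Fin N) (Fin N) ℂ)ˣ)), 1 ≤ Nper ∧ 0 < g ∧
        (𝔯.lit F θ hP g₀ os).ne3 k =
          ⟨Nper, radiusOfRecord N F.L Nper, radiusOfRecord N F.L Nper / 2, g, constOfRecord N F.L Nper g, radiusOfRecord N F.L Nper, Λ₂', dom⟩)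
    (hslot : ∀ (F : T4Family) (D : Datum F N) (hD : IsDatumOfRecord₁₂C F N D) (g₀ : ℕ → ℝ) (os : List (ULoop F)) (k : ℕ),
      PrintSlot (ne3OfRecord₁₁ F ((𝔯.lit F hD.params hD.provisos g₀ os).ne3 k))) :
    S_N16 (RRec₁₂ 𝔯) :=
  s_N16_of_admits_canonical_printSlot (key := fun F D => IsDatumOfRecord₁₂C F N D)
    (fun hD g₀ os k => (𝔯.lit _ hD.params hD.provisos g₀ os).ne3 k) (RRec₁₂ 𝔯) (admits_rRec₁₂ 𝔯)
    (fun F _ hD g₀ os k => hcanon F hD.params hD.provisos g₀ os k) hslot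

/-! ## §3 N21's face at the Stage-12 home -/

/-- **N21's FACE AT THE STAGE-12 HOME OF RECORD** — under `S_N16 (RRec₁₂ 𝔯)`, at every Stage-12 datum key, `(g₀, os)` and run length the covariant root
`NE3EnergyRateWCov 4 (sfClass 4 L o.Nper o.ε) L o.Nper o.b o.g o.C o.Λ₁ o.Λ₂' o.dom` holds, `L = ne3LOfRecord₁₁ F`, `o = (𝔯.lit F hD.params hD.provisos g₀ os).ne3 k`
(file 5's `covRoot_of_attains` at `attains_rRec₁₂`; what `…N21ClosenessAtRecord` reads as `hcov` at Stage 12). [folklore] -/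
theorem covRoot_rRec₁₂ (𝔯 : RateReading₁₂ N) (hS : S_N16 (RRec₁₂ 𝔯)) (F : T4Family) (D : Datum F N) (hD : IsDatumOfRecord₁₂C F N D) (g₀ : ℕ → ℝ)
    (os : List (ULoop F)) (k : ℕ) :
    NE3EnergyRateWCov 4
      (sfClass 4 (ne3LOfRecord₁₁ F) ((𝔯.lit F hD.params hD.provisos g₀ os).ne3 k).Nper ((𝔯.lit F hD.params hD.provisos g₀ os).ne3 k).ε) (ne3LOfRecord₁₁ F)
      ((𝔯.lit F hD.params hD.provisos g₀ os).ne3 k).Nper ((𝔯.lit F hD.params hD.provisos g₀ os).ne3 k).b ((𝔯.lit F hD.params hD.provisos g₀ os).ne3 k).g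
      ((𝔯.lit F hD.params hD.provisos g₀ os).ne3 k).C ((𝔯.lit F hD.params hD.provisos g₀ os).ne3 k).Λ₁ ((𝔯.lit F hD.params hD.provisos g₀ os).ne3 k).Λ₂'
      ((𝔯.lit F hD.params hD.provisos g₀ os).ne3 k).dom :=
  covRoot_of_attains (key := fun F D => IsDatumOfRecord₁₂C F N D) (fun hD g₀ os k => (𝔯.lit _ hD.params hD.provisos g₀ os).ne3 k) (RRec₁₂ 𝔯)
    (attains_rRec₁₂ 𝔯) hS F D hD g₀ os k

/-! ## §4 The junk tests at the Stage-12 home: the pin of `𝔯.lit · ne3` decides -/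

/-- **A STAGE-12 READING WITH FLAT NE3 DATA HAS `S_N16 (RRec₁₂ 𝔯)` — CONTENT-FREE** [decided toy]: if every NE3 object of the reading (all families, Stage-12 tuples
with provisos, `(g₀, os)`, run lengths) has period `≥ 1`, non-negative `ε, C, Λ₁, Λ₂'` and the flat stratum of its period as data, the stub at the Stage-12 home holds
by n16-a's `n16At_flatStratum` — no slot, no estimate.  So the `dom` pin is where N16's content enters the home. [folklore] -/
theorem s_N16_rRec₁₂_of_flatReading (𝔯 : RateReading₁₂ N)
    (hflat : ∀ (F : T4Family) (θ : Stage12Params F N) (hP : θ.Provisos₁₂ F N) (g₀ : ℕ → ℝ) (os : List (ULoop F)) (k : ℕ),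
      1 ≤ ((𝔯.lit F θ hP g₀ os).ne3 k).Nper ∧ 0 ≤ ((𝔯.lit F θ hP g₀ os).ne3 k).ε ∧ 0 ≤ ((𝔯.lit F θ hP g₀ os).ne3 k).C ∧ 0 ≤ ((𝔯.lit F θ hP g₀ os).ne3 k).Λ₁ ∧
        0 ≤ ((𝔯.lit F θ hP g₀ os).ne3 k).Λ₂' ∧
        ((𝔯.lit F θ hP g₀ os).ne3 k).dom = {v : Site 4 → Fin 4 → (Matrix (Fin N) (Fin N) ℂ)ˣ | IsPeriodicCfg v (((𝔯.lit F θ hP g₀ os).ne3 k).Nper : ℤ) ∧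
          ∃ w : Site 4 → (Matrix (Fin N) (Fin N) ℂ)ˣ, IsUnitarySite w ∧ v = gaugeAct w flatCfg}) :
    S_N16 (RRec₁₂ 𝔯) :=
  s_N16_of_admits_flat (key := fun F D => IsDatumOfRecord₁₂C F N D) (fun hD g₀ os k => (𝔯.lit _ hD.params hD.provisos g₀ os).ne3 k) (RRec₁₂ 𝔯)
    (admits_rRec₁₂ 𝔯) fun F _ hD g₀ os k => hflat F hD.params hD.provisos g₀ os k

/-- **A STAGE-12 READING WITH A NEGATIVE-LIPSCHITZ OBJECT AT SOME DATUM OF RECORD HAS NO `S_N16 (RRec₁₂ 𝔯)`** [decided toy]: if at the canonical parameter of some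
Stage-12 datum of record, some `(g₀, os, k)`, the reading's NE3 object has `Λ₁ = −1`, `g = gradConst 4 c′`, `ε, b, c′ ≥ 0` and flat data, the stub at the home FAILS
(file 5's key-free `not_s_N16_of_pins_negLip` at layer B's `rRec₁₂_self`) — letters left free in the reading are refuted; the pin owes `InEndRegime`. [folklore] -/
theorem not_s_N16_rRec₁₂_of_negLipReading (𝔯 : RateReading₁₂ N) {F : T4Family} {D : Datum F N} (hD : IsDatumOfRecord₁₂C F N D) (g₀ : ℕ → ℝ)
    (os : List (ULoop F)) (k : ℕ) {c' : ℝ} (hε : 0 ≤ ((𝔯.lit F hD.params hD.provisos g₀ os).ne3 k).ε) (hb : 0 ≤ ((𝔯.lit F hD.params hD.provisos g₀ os).ne3 k).b)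
    (hc' : 0 ≤ c') (hg : ((𝔯.lit F hD.params hD.provisos g₀ os).ne3 k).g = gradConst 4 c') (hΛ₁ : ((𝔯.lit F hD.params hD.provisos g₀ os).ne3 k).Λ₁ = -1)
    (hdom : ((𝔯.lit F hD.params hD.provisos g₀ os).ne3 k).dom = {v : Site 4 → Fin 4 → (Matrix (Fin N) (Fin N) ℂ)ˣ |
      IsPeriodicCfg v (((𝔯.lit F hD.params hD.provisos g₀ os).ne3 k).Nper : ℤ) ∧
        ∃ w : Site 4 → (Matrix (Fin N) (Fin N) ℂ)ˣ, IsUnitarySite w ∧ v = gaugeAct w flatCfg}) :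
    ¬ S_N16 (RRec₁₂ 𝔯) :=
  not_s_N16_of_pins_negLip (RRec₁₂ 𝔯) (rRec₁₂_self 𝔯 hD g₀ os k) ((𝔯.lit F hD.params hD.provisos g₀ os).ne3 k) rfl hε hb hc' hg hΛ₁ hdom

/-- **THE STAGE-12 READING TYPE ADMITS CONSTANT NE3 OBJECTS** (any `o`; U3 ∕ NE2 components from RR-1's `nonempty_rateObjects₁₁`, the dressed-tower component the
doubling toy `growingTower`) — so both junk tests bite. [folklore] -/
theorem exists_reading₁₂_ne3_const (o : NE3Objects₁₁ N) :
    ∃ 𝔯 : RateReading₁₂ N, ∀ (F : T4Family) (θ : Stage12Params F N) (hP : θ.Provisos₁₂ F N) (g₀ : ℕ → ℝ) (os : List (ULoop F)) (k : ℕ),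
      (𝔯.lit F θ hP g₀ os).ne3 k = o := by
  obtain ⟨r₀⟩ := nonempty_rateObjects₁₁ (N := N)
  exact ⟨⟨fun _ _ _ _ _ => ⟨r₀.u3, fun _ => o, r₀.ne2⟩, fun _ _ _ _ _ => ⟨Unit, growingTower, 1⟩⟩, fun _ _ _ _ _ _ => rfl⟩

/-- **SOME STAGE-12 READING CLOSES THE STUB AT THE HOME OUTRIGHT** [decided toy]: the constant reading at the flat object of period `1` with zero letters. [folklore] -/
theorem exists_reading_s_N16_rRec₁₂ : ∃ 𝔯 : RateReading₁₂ N, S_N16 (RRec₁₂ 𝔯) := by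
  obtain ⟨𝔯, h𝔯⟩ := exists_reading₁₂_ne3_const (N := N)
    ⟨1, 0, 0, 0, 0, 0, 0, {v : Site 4 → Fin 4 → (Matrix (Fin N) (Fin N) ℂ)ˣ | IsPeriodicCfg v ((1 : ℕ) : ℤ) ∧
      ∃ w : Site 4 → (Matrix (Fin N) (Fin N) ℂ)ˣ, IsUnitarySite w ∧ v = gaugeAct w flatCfg}⟩
  refine ⟨𝔯, s_N16_rRec₁₂_of_flatReading 𝔯 fun F θ hP g₀ os k => ?_⟩
  rw [h𝔯 F θ hP g₀ os k]
  exact ⟨le_rfl, le_rfl, le_rfl, le_rfl, le_rfl, rfl⟩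

/-- **GIVEN A STAGE-12 DATUM OF RECORD, SOME READING REFUTES THE STUB AT THE HOME** [decided toy] (the hypothesis is the datum shadow of K0′ `Record12Inhabited` at rank
`N` — RR-2's `exists_isDatumOfRecord₁₂C_iff_exists_record` —, OPEN: claimed by no one): the constant reading at the `Λ₁ = −1` flat object. [folklore] -/
theorem exists_reading_not_s_N16_rRec₁₂ (hex : ∃ (F : T4Family) (D : Datum F N), IsDatumOfRecord₁₂C F N D) :
    ∃ 𝔯 : RateReading₁₂ N, ¬ S_N16 (RRec₁₂ 𝔯) := by
  obtain ⟨F, D, hD⟩ := hex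
  obtain ⟨𝔯, h𝔯⟩ := exists_reading₁₂_ne3_const (N := N)
    ⟨1, 0, 0, gradConst 4 0, 0, -1, 0, {v : Site 4 → Fin 4 → (Matrix (Fin N) (Fin N) ℂ)ˣ | IsPeriodicCfg v ((1 : ℕ) : ℤ) ∧
      ∃ w : Site 4 → (Matrix (Fin N) (Fin N) ℂ)ˣ, IsUnitarySite w ∧ v = gaugeAct w flatCfg}⟩
  have ho := h𝔯 F hD.params hD.provisos (fun _ => 0) [] 0
  refine ⟨𝔯, not_s_N16_rRec₁₂_of_negLipReading 𝔯 hD (fun _ => 0) [] 0 (c' := 0) ?_ ?_ le_rfl ?_ ?_ ?_⟩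
  · rw [ho]
  · rw [ho]
  · rw [ho]
  · rw [ho]
  · rw [ho]

end

end Summit.QuantumFields.YangMills.BalabanUVNodes.N16AtRRec12
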